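import Literature.NumberTheory.Sieve.PolymathProductTestFunctions
import Literature.Analysis.Convolution.ConvolutionPowerDiscretization
import Mathlib.Analysis.SpecialFunctions.Integrals.Basic
import HarnessLib

/-!
# Lattice (kernel-certificate) lower bounds for the Maynard functional of product test functions

Topic `Literature/NumberTheory/Sieve`, namespace `Literature.NumberTheory.Sieve.MaynardTao` (companion of
`PolymathProductTestFunctions`).  Everything here is PROVED; standard axioms.

`PolymathProductTestFunctions` writes the Maynard functional of Polymath's product test function
`F = 1_{R_k} ∏ g(tᵢ)` [cite: Polymath8b2014, §6, proof of Theorem 6.7] as `k · N / D` with the two one-dimensional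
convolution integrals `D = ∫_{(0,1]} (g²)^{⋆k}`, `N = ∫_{(0,1]} (∫₀^{1−w} g)² (g²)^{⋆(k−1)}(w) dw`
(`maynardFunctional_productTestFn`).  The lattice discretisation sandwich of
`Literature/Analysis/Convolution/ConvolutionPowerDiscretization.lean` (rounding every convolution factor down / up to
a lattice `hℕ`: the usual stochastic order is closed under convolution [cite: ShakedShanthikumar2007, Thm 1.A.3(b)])
bounds `D` from above and `N` from below by FINITE expressions in the cell masses `p_j = ∫_{(jh,(j+1)h]} g²` and
their discrete convolution powers `(p^{∗n})_m = dconvPow p n m`: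

* `maynardFunctional_productTestFn_ge_latticeRatio` — for any locally bounded `g ≥ 0`, span `h > 0`, `M h > 1`:
  `k · N_low / D_up ≤ (Σ_m J^{(m)}(F)) / I(F)`,
  `D_up = Σ_{m<M} (p^{∗k})_m`, `N_low = Σ_{m<M'} (∫_{(0, 1−(m+k−1)h]} g)² (p^{∗(k−1)})_m`;
* for Polymath's profile `g = 1_{[0,T]}/(c + (k−1)t)` [cite: Polymath8b2014, Theorem 6.7] the data are explicit:
  the cell masses are the RATIONAL numbers `(1/(k−1)) (1/(c + (k−1)a) − 1/(c + (k−1)b))` for a cell `(a,b] ⊆ [0,T]`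
  (`cellMass_polymathProfile_sq`, with the cells beyond `T` vanishing and the straddling cell cut at `T`), and the
  primitive is `∫_{(0,x]} g = (1/(k−1)) log((c + (k−1) min(x⁺,T))/c)` (`setIntegral_Ioc_polymathProfile`); whence
  `maynardFunctional_polymathProfile_ge_lattice`, a lower bound for `(Σ J)/I` by a finite expression in rationals
  and finitely many logarithms — the shape a kernel certificate (exact big-integer convolution powers, outward
  rounded; `dconvPow_add`, `dconvPow_mono`) verifies.
-/

noncomputable section

open MeasureTheory Set Finset Literature.Analysis.Convolution
open scoped BigOperators

namespace Literature.NumberTheory.Sieve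

namespace MaynardTao

/-! ### The lattice ratio bound for a general profile -/

/-- Squares of locally bounded functions are locally bounded. [folklore] -/
private theorem locBdd_sq' {g : ℝ → ℝ} (hg : LocBdd g) : LocBdd fun t => g t ^ 2 := by
  have : (fun t => g t ^ 2) = fun t => g t * g t := by funext t; ring
  rw [this]
  exact hg.mul hg

/-- **Lattice lower bound for the functional of a product test function.**  For a locally bounded profile
`g ≥ 0`, `k = n + 2 ≥ 2`, a span `h > 0`, `M` with `M h > 1`, any `M'`, and `I(F) > 0`:
`k · N_low / D_up ≤ (Σ_m J^{(m)}(F))/I(F)` for `F = 1_{R_k} ∏ g(tᵢ)`, where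
`D_up = Σ_{m<M} (p^{∗k})_m ≥ D = I(F)` and `N_low = Σ_{m<M'} (∫_{(0,1−(m+k−1)h]} g)² (p^{∗(k−1)})_m ≤ N = J_k(F)`
(`p_j = ∫_{(jh,(j+1)h]} g²`): the representation `k J_k(F)/I(F)` of the proof of Theorem 6.7 with both convolution
integrals discretised outward. [cite: Polymath8b2014, §6, proof of Theorem 6.7 (I(F), J_k(F))] -/
theorem maynardFunctional_productTestFn_ge_latticeRatio (n : ℕ) {g : ℝ → ℝ} (hg : LocBdd g)
    (hg0 : ∀ t, 0 ≤ g t) {h : ℝ} (hh : 0 < h) {M : ℕ} (hM : 1 < (M : ℝ) * h) (M' : ℕ)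
    (hI : 0 < maynardI (n + 2) (productTestFn (n + 2) g)) :
    (n + 2 : ℝ) *
        (∑ m ∈ range M', (∫ u in Ioc 0 (1 - ((m + (n + 1) : ℕ) : ℝ) * h), g u) ^ 2 *
          dconvPow (cellMass (fun t => g t ^ 2) h) (n + 1) m) /
        (∑ m ∈ range M, dconvPow (cellMass (fun t => g t ^ 2) h) (n + 2) m) ≤
      maynardFunctional (n + 2) (productTestFn (n + 2) g) := by
  have hg2 : LocBdd (fun t => g t ^ 2) := locBdd_sq' hg
  rw [maynardFunctional_productTestFn n hg]
  set N := ∫ w in Ioc (0:ℝ) 1, (∫ u in (0:ℝ)..(1 - w), g u) ^ 2 * cpow (fun t => g t ^ 2) (n + 1) w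
    with hN
  set D := ∫ w in Ioc (0:ℝ) 1, cpow (fun t => g t ^ 2) (n + 2) w with hD
  have hDup : D ≤ ∑ m ∈ range M, dconvPow (cellMass (fun t => g t ^ 2) h) (n + 2) m :=
    setIntegral_cpow_le_sum_dconvPow hg2 (fun t => sq_nonneg _) hh hM (k := n + 2) (by omega)
  have hNlow : ∑ m ∈ range M', (∫ u in Ioc 0 (1 - ((m + (n + 1) : ℕ) : ℝ) * h), g u) ^ 2 *
      dconvPow (cellMass (fun t => g t ^ 2) h) (n + 1) m ≤ N :=
    sum_primitiveSq_mul_dconvPow_le hg hg0 hh n M'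
  have hDpos : 0 < D := by
    rw [maynardI_productTestFn_eq_cpow (k := n + 2) (by omega) hg] at hI
    exact hI
  have hNlow0 : 0 ≤ ∑ m ∈ range M', (∫ u in Ioc 0 (1 - ((m + (n + 1) : ℕ) : ℝ) * h), g u) ^ 2 *
      dconvPow (cellMass (fun t => g t ^ 2) h) (n + 1) m :=
    Finset.sum_nonneg fun m _ =>
      mul_nonneg (sq_nonneg _) (dconvPow_nonneg (cellMass_nonneg (fun t => sq_nonneg _) h) _ _)
  have hk0 : (0:ℝ) ≤ n + 2 := by positivity
  exact div_le_div₀ (mul_nonneg hk0 (hNlow0.trans hNlow)) (mul_le_mul_of_nonneg_left hNlow hk0) hDpos hDup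

/-! ### Polymath's profile: exact cell masses and primitive -/

section Profile

variable {k : ℕ} {c T : ℝ}

/-- On `[0,T]` the squared profile is `1/(c + (k−1)t)²`. [cite: Polymath8b2014, Theorem 6.7 (definition of g)] -/
theorem polymathProfile_sq_of_mem {t : ℝ} (ht : t ∈ Icc (0:ℝ) T) :
    polymathProfile k c T t ^ 2 = 1 / (c + ((k:ℝ) - 1) * t) ^ 2 := by
  rw [polymathProfile, Set.indicator_of_mem ht, one_div, one_div, inv_pow]

/-- The integrand `1/(c + (k−1)t)²` on an interval `[a,b] ⊆ [0,∞)` (`c > 0`, `k ≥ 2`):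
`∫_a^b dt/(c+(k−1)t)² = (1/(k−1)) (1/(c+(k−1)a) − 1/(c+(k−1)b))` — the antiderivative `−1/((k−1)(c+(k−1)t))`
behind `m₂ = ∫₀ᵀ g²` of Theorem 6.7. [cite: Polymath8b2014, Theorem 6.7 (definition of m_2)] -/
theorem integral_inv_sq_affine (hk : 2 ≤ k) (hc : 0 < c) {a b : ℝ} (ha : 0 ≤ a) (hab : a ≤ b) :
    ∫ t in a..b, 1 / (c + ((k:ℝ) - 1) * t) ^ 2 =
      1 / ((k:ℝ) - 1) * (1 / (c + ((k:ℝ) - 1) * a) - 1 / (c + ((k:ℝ) - 1) * b)) := by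
  have hk1 : (0:ℝ) < (k:ℝ) - 1 := by
    have : (2:ℝ) ≤ k := by exact_mod_cast hk
    linarith
  set κ : ℝ := (k:ℝ) - 1 with hκ
  -- antiderivative `Φ(t) = -1/(κ (c + κ t))`
  have hpos : ∀ t ∈ uIcc a b, 0 < c + κ * t := by
    intro t ht
    rw [uIcc_of_le hab] at ht
    nlinarith [ht.1]
  have hderiv : ∀ t ∈ uIcc a b,
      HasDerivAt (fun t => -(1 / κ) * (c + κ * t)⁻¹) (1 / (c + κ * t) ^ 2) t := by
    intro t ht
    have hne : c + κ * t ≠ 0 := (hpos t ht).ne'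
    have h1 : HasDerivAt (fun t => c + κ * t) κ t := by
      simpa using (hasDerivAt_id t).const_mul κ |>.const_add c
    have h2 := (h1.inv hne).const_mul (-(1 / κ))
    refine h2.congr_deriv ?_
    have hκ0 : κ ≠ 0 := hk1.ne'
    field_simp
  have hcont : ContinuousOn (fun t => 1 / (c + κ * t) ^ 2) (uIcc a b) := by
    refine ContinuousOn.div continuousOn_const ((continuousOn_const.add
      (continuousOn_const.mul continuousOn_id)).pow 2) fun t ht => ?_
    exact pow_ne_zero 2 (hpos t ht).ne'
  rw [intervalIntegral.integral_eq_sub_of_hasDerivAt hderiv (hcont.intervalIntegrable)]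
  ring

/-- **Exact cell masses of Polymath's profile, cells inside `[0,T]`**: for `c > 0`, `k ≥ 2`, `h > 0` and
`(j+1)h ≤ T`, `∫_{(jh,(j+1)h]} g² = (1/(k−1)) (1/(c+(k−1)jh) − 1/(c+(k−1)(j+1)h))` — a rational number for
rational `c, h`. [cite: Polymath8b2014, Theorem 6.7 (definition of g, m_2)] -/
theorem cellMass_polymathProfile_sq (hk : 2 ≤ k) (hc : 0 < c) {h : ℝ} (hh : 0 < h) {j : ℕ}
    (hj : ((j : ℝ) + 1) * h ≤ T) :
    cellMass (fun t => polymathProfile k c T t ^ 2) h j =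
      1 / ((k:ℝ) - 1) * (1 / (c + ((k:ℝ) - 1) * (j * h)) - 1 / (c + ((k:ℝ) - 1) * ((j + 1) * h))) := by
  have hjh : (0:ℝ) ≤ j * h := by positivity
  have hab : (j : ℝ) * h ≤ ((j : ℝ) + 1) * h := by nlinarith
  rw [cellMass_eq_intervalIntegral _ hh.le, ← integral_inv_sq_affine hk hc hjh hab]
  refine intervalIntegral.integral_congr fun t ht => ?_
  rw [uIcc_of_le hab] at ht
  exact polymathProfile_sq_of_mem ⟨hjh.trans ht.1, ht.2.trans hj⟩

/-- **The cell straddling `T`**: for `jh ≤ T ≤ (j+1)h`,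
`∫_{(jh,(j+1)h]} g² = (1/(k−1)) (1/(c+(k−1)jh) − 1/(c+(k−1)T))`. [cite: Polymath8b2014, Theorem 6.7 (definition of g, m_2)] -/
theorem cellMass_polymathProfile_sq_straddle (hk : 2 ≤ k) (hc : 0 < c) {h : ℝ} (hh : 0 < h) {j : ℕ}
    (hj : (j : ℝ) * h ≤ T) (hjT : T ≤ ((j : ℝ) + 1) * h) :
    cellMass (fun t => polymathProfile k c T t ^ 2) h j =
      1 / ((k:ℝ) - 1) * (1 / (c + ((k:ℝ) - 1) * (j * h)) - 1 / (c + ((k:ℝ) - 1) * T)) := by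
  have hjh : (0:ℝ) ≤ j * h := by positivity
  have hg2 : LocBdd (fun t => polymathProfile k c T t ^ 2) :=
    locBdd_sq' (locBdd_polymathProfile (by omega) hc (hjh.trans hj))
  rw [cellMass_eq_intervalIntegral _ hh.le,
    ← intervalIntegral.integral_add_adjacent_intervals (b := T)
      (intervalIntegrable_iff.2 (hg2.integrableOn_Ioc _ _))
      (intervalIntegrable_iff.2 (hg2.integrableOn_Ioc _ _)),
    ← integral_inv_sq_affine hk hc hjh hj]
  have h1 : ∫ t in ((j:ℝ) * h)..T, polymathProfile k c T t ^ 2 =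
      ∫ t in ((j:ℝ) * h)..T, 1 / (c + ((k:ℝ) - 1) * t) ^ 2 := by
    refine intervalIntegral.integral_congr fun t ht => ?_
    rw [uIcc_of_le hj] at ht
    exact polymathProfile_sq_of_mem ⟨hjh.trans ht.1, ht.2⟩
  have h2 : ∫ t in T..(((j:ℝ) + 1) * h), polymathProfile k c T t ^ 2 = 0 := by
    rw [intervalIntegral.integral_of_le hjT]
    refine (setIntegral_congr_fun measurableSet_Ioc (g := fun _ => (0:ℝ)) fun t ht => ?_).trans
      (by simp)
    have : t ∉ Icc (0:ℝ) T := fun h' => (not_lt.2 h'.2) ht.1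
    simp [polymathProfile_of_notMem this]
  rw [h1, h2, add_zero]

/-- **Cells beyond `T` carry no mass**: for `T ≤ jh`, `∫_{(jh,(j+1)h]} g² = 0`.
[cite: Polymath8b2014, Theorem 6.7 (definition of g)] -/
theorem cellMass_polymathProfile_sq_eq_zero {h : ℝ} {j : ℕ} (hj : T ≤ (j : ℝ) * h) :
    cellMass (fun t => polymathProfile k c T t ^ 2) h j = 0 := by
  rw [cellMass]
  refine (setIntegral_congr_fun measurableSet_Ioc (g := fun _ => (0:ℝ)) fun t ht => ?_).trans (by simp)
  have : t ∉ Icc (0:ℝ) T := fun h' => (not_lt.2 h'.2) (hj.trans_lt ht.1)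
  simp [polymathProfile_of_notMem this]

/-- **The primitive of Polymath's profile**: for `c > 0`, `k ≥ 2`, `T > 0` and every real `x`,
`∫_{(0,x]} g = (1/(k−1)) log((c + (k−1) min(max(x,0), T))/c)` (the quantity `∫_{[0,r−S_{k−1}]} g` of the proof of
Theorem 6.7, evaluated). [cite: Polymath8b2014, §6, proof of Theorem 6.7 (∫_{[0,r−S_{k−1}]} g(t) dt)] -/
theorem setIntegral_Ioc_polymathProfile (hk : 2 ≤ k) (hc : 0 < c) (hT : 0 < T) (x : ℝ) :
    ∫ u in Ioc 0 x, polymathProfile k c T u =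
      1 / ((k:ℝ) - 1) * Real.log ((c + ((k:ℝ) - 1) * min (max x 0) T) / c) := by
  have hk1 : (0:ℝ) < (k:ℝ) - 1 := by
    have : (2:ℝ) ≤ k := by exact_mod_cast hk
    linarith
  set κ : ℝ := (k:ℝ) - 1 with hκ
  by_cases hx : x ≤ 0
  · rw [max_eq_right hx, min_eq_left hT.le, mul_zero, add_zero, div_self hc.ne', Real.log_one,
      mul_zero, Ioc_eq_empty (not_lt.2 hx), Measure.restrict_empty, integral_zero_measure]
  have hx0 : 0 < x := not_le.1 hx
  rw [max_eq_left hx0.le]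
  set y : ℝ := min x T with hy
  have hy0 : 0 < y := lt_min hx0 hT
  have hyT : y ≤ T := min_le_right _ _
  have hg : LocBdd (polymathProfile k c T) := locBdd_polymathProfile (by omega) hc hT.le
  -- `∫_{(0,x]} g = ∫_{(0,y]} g`: the profile vanishes on `(y, x]` when `x > T`
  have hsplit : ∫ u in Ioc 0 x, polymathProfile k c T u = ∫ u in Ioc 0 y, polymathProfile k c T u := by
    rw [← intervalIntegral.integral_of_le hx0.le, ← intervalIntegral.integral_of_le hy0.le,
      ← intervalIntegral.integral_add_adjacent_intervals (b := y)
        (intervalIntegrable_iff.2 (hg.integrableOn_Ioc _ _))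
        (intervalIntegrable_iff.2 (hg.integrableOn_Ioc _ _))]
    have h2 : ∫ u in y..x, polymathProfile k c T u = 0 := by
      rw [intervalIntegral.integral_of_le (min_le_left _ _)]
      refine (setIntegral_congr_fun measurableSet_Ioc (g := fun _ => (0:ℝ)) fun t ht => ?_).trans
        (by simp)
      by_cases hxT : x ≤ T
      · -- then `y = x` and `(y, x]` is empty
        exact absurd (ht.1.trans_le ht.2) (by rw [min_eq_left hxT]; exact lt_irrefl x)
      · have hyT' : y = T := by rw [hy, min_eq_right (not_le.1 hxT).le]
        have : t ∉ Icc (0:ℝ) T := fun h' => (not_lt.2 h'.2) (hyT' ▸ ht.1)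
        exact polymathProfile_of_notMem this
    rw [h2, add_zero]
  rw [hsplit, ← intervalIntegral.integral_of_le hy0.le]
  -- on `[0, y] ⊆ [0, T]` the profile is `1/(c + κ u)`, with primitive `log(c + κ u)/κ`
  have hcongr : ∫ u in (0:ℝ)..y, polymathProfile k c T u = ∫ u in (0:ℝ)..y, 1 / (c + κ * u) := by
    refine intervalIntegral.integral_congr fun u hu => ?_
    rw [uIcc_of_le hy0.le] at hu
    rw [polymathProfile, Set.indicator_of_mem (show u ∈ Icc (0:ℝ) T from ⟨hu.1, hu.2.trans hyT⟩)]
  have hpos : ∀ u ∈ uIcc (0:ℝ) y, 0 < c + κ * u := by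
    intro u hu
    rw [uIcc_of_le hy0.le] at hu
    nlinarith [hu.1]
  have hderiv : ∀ u ∈ uIcc (0:ℝ) y,
      HasDerivAt (fun u => 1 / κ * Real.log (c + κ * u)) (1 / (c + κ * u)) u := by
    intro u hu
    have hne : c + κ * u ≠ 0 := (hpos u hu).ne'
    have h1 : HasDerivAt (fun u => c + κ * u) κ u := by
      simpa using (hasDerivAt_id u).const_mul κ |>.const_add c
    have h2 := (h1.log hne).const_mul (1 / κ)
    refine h2.congr_deriv ?_
    have hκ0 : κ ≠ 0 := hk1.ne'
    field_simp
  have hcont : ContinuousOn (fun u => 1 / (c + κ * u)) (uIcc (0:ℝ) y) :=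
    ContinuousOn.div continuousOn_const (continuousOn_const.add (continuousOn_const.mul continuousOn_id))
      fun u hu => (hpos u hu).ne'
  rw [hcongr, intervalIntegral.integral_eq_sub_of_hasDerivAt hderiv hcont.intervalIntegrable]
  have hcy : 0 < c + κ * y := hpos y (by rw [uIcc_of_le hy0.le]; exact ⟨hy0.le, le_rfl⟩)
  rw [mul_zero, add_zero, ← mul_sub, Real.log_div hcy.ne' hc.ne']

end Profile

/-! ### The explicit lattice bound for Polymath's product family -/

/-- **Kernel-certificate shape of `M_k ≥ …` for Polymath's product test function.**  For `k = n + 2`, `c, T, h > 0`,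
`M h > 1` and any `M'`, with `g = 1_{[0,T]}/(c+(k−1)t)`, `p_j = ∫_{(jh,(j+1)h]} g²` (rational, by
`cellMass_polymathProfile_sq`) and `x_m = 1 − (m+k−1)h`:
`k · (Σ_{m<M'} ((1/(k−1)) log((c+(k−1)min(x_m⁺,T))/c))² (p^{∗(k−1)})_m) / (Σ_{m<M} (p^{∗k})_m) ≤ (Σ J^{(m)}(F))/I(F)`
— the proof-of-Theorem-6.7 ratio `k J_k(F)/I(F)` with both convolution integrals discretised outward, i.e. a lower
bound for `M_k` by finitely many rationals and logarithms. [cite: Polymath8b2014, §6, proof of Theorem 6.7 (I(F), J_k(F))] -/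
theorem maynardFunctional_polymathProfile_ge_lattice (n : ℕ) {c T h : ℝ} (hc : 0 < c) (hT : 0 < T)
    (hh : 0 < h) {M : ℕ} (hM : 1 < (M : ℝ) * h) (M' : ℕ) :
    (n + 2 : ℝ) *
        (∑ m ∈ range M',
          (1 / ((n:ℝ) + 1) *
              Real.log ((c + ((n:ℝ) + 1) * min (max (1 - ((m + (n + 1) : ℕ) : ℝ) * h) 0) T) / c)) ^ 2 *
            dconvPow (cellMass (fun t => polymathProfile (n + 2) c T t ^ 2) h) (n + 1) m) /
        (∑ m ∈ range M, dconvPow (cellMass (fun t => polymathProfile (n + 2) c T t ^ 2) h) (n + 2) m) ≤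
      maynardFunctional (n + 2) (productTestFn (n + 2) (polymathProfile (n + 2) c T)) := by
  have hg : LocBdd (polymathProfile (n + 2) c T) := locBdd_polymathProfile (by omega) hc hT.le
  have hg0 : ∀ t, 0 ≤ polymathProfile (n + 2) c T t := by
    intro t
    by_cases ht : t ∈ Icc (0:ℝ) T
    · have h1 := (polymathProfile_mem_Icc (k := n + 2) (by omega) hc hT.le ht).1
      refine le_trans (one_div_pos.2 ?_).le h1
      have : (0:ℝ) ≤ ((n + 2 : ℕ) : ℝ) - 1 := by push_cast; linarith
      nlinarith [ht.2, hT]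
    · rw [polymathProfile_of_notMem ht]
  have hI := (isMaynardAdmissible_productTestFn_polymathProfile (k := n + 2) (by omega) hc hT).maynardI_pos
  have hmain := maynardFunctional_productTestFn_ge_latticeRatio n hg hg0 hh hM M' hI
  have hprim : ∀ m : ℕ,
      ∫ u in Ioc 0 (1 - ((m + (n + 1) : ℕ) : ℝ) * h), polymathProfile (n + 2) c T u =
        1 / ((n:ℝ) + 1) *
          Real.log ((c + ((n:ℝ) + 1) * min (max (1 - ((m + (n + 1) : ℕ) : ℝ) * h) 0) T) / c) := by
    intro m
    rw [setIntegral_Ioc_polymathProfile (k := n + 2) (by omega) hc hT]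
    push_cast
    ring_nf
  simp_rw [hprim] at hmain
  exact hmain

end MaynardTao

end Literature.NumberTheory.Sieve
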